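import Summits.Ventures.CertifiedArithmetic.LowPrec.SRDyadicGrid
import Summits.Ventures.CertifiedArithmetic.LowPrec.SRSpacing
import Summits.Ventures.CertifiedArithmetic.LowPrec.SRFormatsBridge
import HarnessLib

/-!
# Every minifloat format is a grid format: `emaxCode − 1` random bits reproduce exact SR

HONEST FRAMING: certified error envelopes and provably optimal rounding/accumulation schemes for
low-precision formats under stated cost models; every table by two implementations; no hardware or
vendor claims.

File LXXX of the SR slice.  `SRDyadicGrid` (LXXIX) proved the grid theorem for any `GridFormat F u L`
and decided the grid property by kernel enumeration for FP4/FP6.  Here the grid property is PROVED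
for the value set of EVERY minifloat format `φ` of the substrate (`Format` = trailing significand
bits `m`, bias, top exponent code `emaxCode`, top significand; subnormals, both signs, any saturation
value) — structurally, from the directed-rounding grid (`rdGrid = ⌊r/2^s⌋2^s`, `ruGrid = ⌈r/2^s⌉2^s`),
with NO enumeration of values — so the limited-randomness thresholds become closed-form theorems for
`binary16`, `bfloat16`, `binary32`, the OCP FP8 pair and the P3109 `binary8pP` family alike:

* `Format.ruGrid_sub_rdGrid_zero_or_pow` — on `[0, maxScaled]` the grid gap is `0` or `2^s` with
  `s ≤ emaxCode − 1`; `valueSet_gap_zero_or_pow` — on the hull the candidate gap of `valueSet φ` is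
  `0` or `2^s · quantum`;
* `valueSet_gridFormat` — **`GridFormat (valueSet φ) quantum (emaxCode − 1)` for every format**;
  `valueSet_dyadic_pUp` — every pre-rounding value on the quantum grid has an `(emaxCode − 1)`-bit
  dyadic up-probability (`emaxCode − 1 = log₂(ulp_max/ulp_min)`);
* whole computations, every format, rules `A`/`B`/`C` with `N` bits: `valueSet_tree_exact`
  (`N ≥ emaxCode − 1`: every summation tree of format data, any order, every test function),
  `valueSet_acc_exact_of_grid` (increments on the grid `quantum/2^j` — format data `j = 0`, or
  finer-grid data such as exact products or data of a wider format — with `N ≥ emaxCode − 1 + j`),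
  `valueSet_ip_exact` (one-stage inner products of format vectors: `N ≥ emaxCode − 1 + (bias + m − 1)`
  = `log₂(ulp_max/ulp_min²)`, via `Format.quantum_eq_two_pow_mul_sq`), and the MIXED-PRECISION form
  `valueSet_ip_exact_mixed` (vectors of formats `φ₁`, `φ₂` accumulated in `φ`:
  `quantum φ = 2^j · quantum φ₁ · quantum φ₂`);
* closed forms (`rfl` on the records): trees / one-stage inner products need at most
  E4M3 `14 / 23`, E5M2 `29 / 45`, binary16 `29 / 53`, bfloat16 `253 / 386`, binary32 `253 / 402`
  bits (`fp8_fp16_fp32_budgets`), with the named corollaries `e4m3_fourteenBits_tree_exact`,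
  `e5m2_twentynineBits_tree_exact`, `binary16_tree_exact`, `bfloat16_tree_exact`,
  `binary32_tree_exact`, `e4m3_ip_exact`, `e5m2_ip_exact`; and FP8 × FP8 products accumulated in
  binary16 / binary32 (`fp8_products_in_binary16_exact`: E4M3·E4M3 and E4M3·E5M2 products lie ON the
  binary16 grid, so `29` bits — the tree budget — already suffice; E5M2·E5M2 in binary16 needs
  `29 + 8 = 37`);
* sharpness by kernel on the FP8 literals (`e4m3_budget_witnesses`, `e5m2_budget_witnesses`:
  `-448 + 2⁻⁹` is not `13`-dyadic, `-448 + 2⁻¹⁸` not `22`-dyadic; `-57344 + 2⁻¹⁶` not `28`-dyadic,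
  `-57344 + 2⁻³²` not `44`-dyadic), so the FP8 bounds `14/23` and `29/45` are thresholds.
-/

namespace Literature.ComputerArithmetic.FloatingPoint

namespace Format

variable {φ : Format}

/-- On `[0, maxScaled]` the directed-rounding grid gap `ruGrid r − rdGrid r` is `0` or `2^s` with
`s = shift ⌊r⌋ ≤ emaxCode − 1`. -/
theorem ruGrid_sub_rdGrid_zero_or_pow {r : ℚ} (hr : 0 ≤ r) (hle : r ≤ φ.maxScaled) :
    (φ.ruGrid r : ℚ) - φ.rdGrid r = 0 ∨
      ∃ s, s ≤ φ.emaxCode - 1 ∧ (φ.ruGrid r : ℚ) - φ.rdGrid r = 2 ^ s := by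
  set s := φ.shift ⌊r⌋.toNat with hs
  have hc : (0 : ℚ) < 2 ^ s := by positivity
  have h0f : 0 ≤ ⌊r / (2 : ℚ) ^ s⌋ := Int.floor_nonneg.mpr (div_nonneg hr hc.le)
  have h0c : 0 ≤ ⌈r / (2 : ℚ) ^ s⌉ := Int.ceil_nonneg (div_nonneg hr hc.le)
  have e1 : ((⌊r / (2 : ℚ) ^ s⌋.toNat : ℕ) : ℚ) = (⌊r / (2 : ℚ) ^ s⌋ : ℚ) := by
    exact_mod_cast Int.toNat_of_nonneg h0f
  have e2 : ((⌈r / (2 : ℚ) ^ s⌉.toNat : ℕ) : ℚ) = (⌈r / (2 : ℚ) ^ s⌉ : ℚ) := by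
    exact_mod_cast Int.toNat_of_nonneg h0c
  have hd : (φ.rdGrid r : ℚ) = (⌊r / (2 : ℚ) ^ s⌋ : ℚ) * 2 ^ s := by
    rw [rdGrid_eq_floor_mul hr hle, ← hs]; push_cast; rw [e1]
  have hu : (φ.ruGrid r : ℚ) = (⌈r / (2 : ℚ) ^ s⌉ : ℚ) * 2 ^ s := by
    unfold ruGrid; rw [if_pos hle, ← hs]; push_cast; rw [e2]
  have h1 := Int.floor_le_ceil (r / (2 : ℚ) ^ s)
  have h2 := Int.ceil_le_floor_add_one (r / (2 : ℚ) ^ s)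
  rcases eq_or_lt_of_le h1 with he | hlt
  · left; rw [hd, hu, he]; ring
  · right
    refine ⟨s, shift_le _, ?_⟩
    have : ⌈r / (2 : ℚ) ^ s⌉ = ⌊r / (2 : ℚ) ^ s⌋ + 1 := le_antisymm h2 (by omega)
    rw [hd, hu, this]; push_cast; ring

/-- `quantum = 2^(bias + m − 1) · quantum²` whenever `bias + m ≥ 1` (the quantum is `2^{−(bias+m−1)}`). -/
theorem quantum_eq_two_pow_mul_sq (h : 1 ≤ φ.bias + φ.manBits) :
    φ.quantum = 2 ^ (φ.bias + φ.manBits - 1) * (φ.quantum * φ.quantum) := by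
  have hcast : ((φ.bias + φ.manBits - 1 : ℕ) : ℤ) = (φ.bias : ℤ) + φ.manBits - 1 := by omega
  have hq : φ.quantum * 2 ^ (φ.bias + φ.manBits - 1) = 1 := by
    unfold quantum
    rw [← zpow_natCast, hcast, ← zpow_add₀ (by norm_num : (2 : ℚ) ≠ 0)]
    have : φ.qexp + ((φ.bias : ℤ) + φ.manBits - 1) = 0 := by unfold qexp; ring
    rw [this, zpow_zero]
  linear_combination (-φ.quantum) * hq

end Format

namespace MiniFloat

open Format

variable {φ : Format}

/-- On the hull, the candidate gap of `valueSet φ` is `0` or `2^s · quantum` with `s ≤ emaxCode − 1`. -/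
theorem valueSet_gap_zero_or_pow (φ : Format) {c : ℚ} (hc : |c| ≤ φ.maxRat) :
    ConnollyHighamMary2021.roundUp (valueSet φ) c - ConnollyHighamMary2021.roundDown (valueSet φ) c
        = 0 ∨
      ∃ s, s ≤ φ.emaxCode - 1 ∧ ConnollyHighamMary2021.roundUp (valueSet φ) c
        - ConnollyHighamMary2021.roundDown (valueSet φ) c = 2 ^ s * φ.quantum := by
  have hq := φ.quantum_pos
  have hr : 0 ≤ |c| / φ.quantum := div_nonneg (abs_nonneg c) hq.le
  have hle : |c| / φ.quantum ≤ φ.maxScaled := by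
    rw [div_le_iff₀ hq]; exact hc.trans (le_of_eq rfl)
  rw [chm_roundUp_eq hc, chm_roundDown_eq hc, roundUp_sub_roundDown_eq]
  rcases ruGrid_sub_rdGrid_zero_or_pow hr hle with h | ⟨s, hs, h⟩
  · left; rw [h, zero_mul]
  · right; exact ⟨s, hs, by rw [h]⟩

/-- Every value of a format is an integer number of quanta. -/
theorem valueSet_onGrid (φ : Format) : ∀ x ∈ valueSet φ,
    Summit.Ventures.CertifiedArithmetic.LowPrec.SR.LimitedBits.OnGrid φ.quantum x := by
  intro x hx
  obtain ⟨y, rfl⟩ := mem_valueSet.mp hx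
  exact ⟨y.toInt, rfl⟩

end MiniFloat

end Literature.ComputerArithmetic.FloatingPoint

namespace Summit.Ventures.CertifiedArithmetic.LowPrec.SR.LimitedBits

open Literature.ComputerArithmetic.P3109
open Literature.ComputerArithmetic.ConnollyHighamMary2021
open Literature.ComputerArithmetic.FloatingPoint (Format MiniFloat)
open Literature.ComputerArithmetic.FloatingPoint.MiniFloat (valueSet valueSet_nonempty)
open Summit.Ventures.CertifiedArithmetic.LowPrec.SR
open Finset STree

/-! ### Every format is a grid format -/

/-- **Every minifloat format is a grid format** with quantum `quantum φ` and width budget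
`emaxCode − 1 = log₂(ulp_max/ulp_min)` — no enumeration. -/
theorem valueSet_gridFormat (φ : Format) : GridFormat (valueSet φ) φ.quantum (φ.emaxCode - 1) := by
  refine ⟨MiniFloat.valueSet_onGrid φ, fun x hx y hy hxy => ?_⟩
  by_cases hz : ∃ z ∈ valueSet φ, x < z ∧ z < y
  · exact Or.inl hz
  · right
    have hgap : ∀ w ∈ valueSet φ, w ≤ x ∨ y ≤ w := fun w hw => by
      by_cases hwx : w ≤ x
      · exact Or.inl hwx
      · exact Or.inr (not_lt.mp fun hwy => hz ⟨w, hw, not_le.mp hwx, hwy⟩)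
    set c := (x + y) / 2 with hc
    have hxc : x < c := by rw [hc]; linarith
    have hcy : c < y := by rw [hc]; linarith
    have hd : roundDown (valueSet φ) c = x := roundDown_eq_of_gap hx hgap hxc.le hcy
    have hu : roundUp (valueSet φ) c = y := roundUp_eq_of_gap hy hgap hxc hcy.le
    obtain ⟨x', rfl⟩ := MiniFloat.mem_valueSet.mp hx
    obtain ⟨y', rfl⟩ := MiniFloat.mem_valueSet.mp hy
    have h1 := MiniFloat.abs_toRat_le_maxRat x'
    have h2 := MiniFloat.abs_toRat_le_maxRat y'
    have hcabs : |c| ≤ φ.maxRat := by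
      rw [abs_le] at h1 h2 ⊢; constructor <;> [rw [hc]; rw [hc]] <;> linarith [h1.1, h2.2]
    rcases MiniFloat.valueSet_gap_zero_or_pow φ hcabs with h | ⟨s, hs, h⟩
    · rw [hd, hu] at h; linarith
    · rw [hd, hu] at h
      exact ⟨s, Finset.mem_range.mpr (by omega), h⟩

/-- **Every format: every pre-rounding value on the quantum grid (in range or saturating) has an
`(emaxCode − 1)`-bit dyadic up-probability.** -/
theorem valueSet_dyadic_pUp (φ : Format) {c : ℚ} (hc : OnGrid φ.quantum c) :
    Dyadic (φ.emaxCode - 1) (pUp (valueSet φ) c) :=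
  dyadic_pUp_of_grid (valueSet_nonempty φ) φ.quantum_pos (valueSet_gridFormat φ) hc

/-! ### Whole computations, every format -/

/-- **Trees, every format.** With `N ≥ emaxCode − 1` random bits, rules `A`, `B`, `C` reproduce the
exact-SR law of every summation tree of format data, in any order, for every test function. -/
theorem valueSet_tree_exact (φ : Format) {N : ℕ} (hN : φ.emaxCode - 1 ≤ N) (T : STree ℚ)
    (hT : LeavesIn (valueSet φ) T) (f : ℚ → ℚ) :
    treeExpQ (valueSet φ) (probAwayA N) T f = treeExp (valueSet φ) T f ∧
    treeExpQ (valueSet φ) (probAwayB N) T f = treeExp (valueSet φ) T f ∧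
    treeExpQ (valueSet φ) (probAwayC N) T f = treeExp (valueSet φ) T f := by
  have hT' := leavesSat_of_leavesIn (valueSet_gridFormat φ).1 T hT
  obtain ⟨hA, hB, hC⟩ := probAwayABC_of_dyadic_le (K := ℚ) hN
  exact ⟨treeExpQ_eq_treeExp_of_grid (valueSet_nonempty φ) φ.quantum_pos (valueSet_gridFormat φ)
      hA T hT' f,
    treeExpQ_eq_treeExp_of_grid (valueSet_nonempty φ) φ.quantum_pos (valueSet_gridFormat φ)
      hB T hT' f,
    treeExpQ_eq_treeExp_of_grid (valueSet_nonempty φ) φ.quantum_pos (valueSet_gridFormat φ)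
      hC T hT' f⟩

/-- **Accumulation, every format, increments on a (possibly finer) binary grid.** If every increment
is a multiple of `quantum/2^j` (format data: `j = 0`; exact products or wider-format data: `j > 0`),
then `N ≥ emaxCode − 1 + j` bits reproduce the exact-SR accumulation in law from every format start,
for every length and test function. -/
theorem valueSet_acc_exact_of_grid (φ : Format) (j : ℕ) {N : ℕ} (hN : φ.emaxCode - 1 + j ≤ N)
    {c : ℕ → ℚ} (hc : ∀ k, OnGrid (φ.quantum / 2 ^ j) (c k)) {s : ℚ} (hs : s ∈ valueSet φ)
    (n : ℕ) (f : ℚ → ℚ) :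
    accExpQ (valueSet φ) (probAwayA N) c n f s = accExp (valueSet φ) c n f s ∧
    accExpQ (valueSet φ) (probAwayB N) c n f s = accExp (valueSet φ) c n f s ∧
    accExpQ (valueSet φ) (probAwayC N) c n f s = accExp (valueSet φ) c n f s := by
  have huv : φ.quantum = 2 ^ j * (φ.quantum / 2 ^ j) := by
    rw [mul_div_cancel₀ _ (pow_ne_zero _ (two_ne_zero))]
  have hG := gridFormat_refine huv (valueSet_gridFormat φ)
  have hv : 0 < φ.quantum / 2 ^ j := div_pos φ.quantum_pos (by positivity)
  obtain ⟨hA, hB, hC⟩ := probAwayABC_of_dyadic_le (K := ℚ) hN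
  exact ⟨accExpQ_eq_accExp_of_grid (valueSet_nonempty φ) hv hG hA hc hs n f,
    accExpQ_eq_accExp_of_grid (valueSet_nonempty φ) hv hG hB hc hs n f,
    accExpQ_eq_accExp_of_grid (valueSet_nonempty φ) hv hG hC hc hs n f⟩

/-- **One-stage inner products, every format.** For format vectors `x`, `y` and
`N ≥ (emaxCode − 1) + (bias + m − 1) = log₂(ulp_max/ulp_min²)` random bits, `ŝ ← SR_N(ŝ + xₖyₖ)`
under `A`, `B`, `C` is the exact-SR inner product in law (every length, start, test function). -/
theorem valueSet_ip_exact (φ : Format) (h1 : 1 ≤ φ.bias + φ.manBits) {N : ℕ}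
    (hN : φ.emaxCode - 1 + (φ.bias + φ.manBits - 1) ≤ N) {x y : ℕ → ℚ}
    (hx : ∀ k, x k ∈ valueSet φ) (hy : ∀ k, y k ∈ valueSet φ) {s : ℚ} (hs : s ∈ valueSet φ)
    (n : ℕ) (f : ℚ → ℚ) :
    accExpQ (valueSet φ) (probAwayA N) (fun k => x k * y k) n f s
        = accExp (valueSet φ) (fun k => x k * y k) n f s ∧
    accExpQ (valueSet φ) (probAwayB N) (fun k => x k * y k) n f s
        = accExp (valueSet φ) (fun k => x k * y k) n f s ∧
    accExpQ (valueSet φ) (probAwayC N) (fun k => x k * y k) n f s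
        = accExp (valueSet φ) (fun k => x k * y k) n f s := by
  have huv := Format.quantum_eq_two_pow_mul_sq h1
  have hG := gridFormat_refine huv (valueSet_gridFormat φ)
  have hv : 0 < φ.quantum * φ.quantum := mul_pos φ.quantum_pos φ.quantum_pos
  have hc : ∀ k, OnGrid (φ.quantum * φ.quantum) (x k * y k) := fun k =>
    ((valueSet_gridFormat φ).1 _ (hx k)).mul ((valueSet_gridFormat φ).1 _ (hy k))
  obtain ⟨hA, hB, hC⟩ := probAwayABC_of_dyadic_le (K := ℚ) hN
  exact ⟨accExpQ_eq_accExp_of_grid (valueSet_nonempty φ) hv hG hA hc hs n f,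
    accExpQ_eq_accExp_of_grid (valueSet_nonempty φ) hv hG hB hc hs n f,
    accExpQ_eq_accExp_of_grid (valueSet_nonempty φ) hv hG hC hc hs n f⟩

/-- **Mixed precision.** Vectors of formats `φ₁`, `φ₂` accumulated one-stage in format `φ` whose
quantum is `2^j ·` (the product quantum): `N ≥ emaxCode φ − 1 + j` bits are exact in law. -/
theorem valueSet_ip_exact_mixed (φ φ₁ φ₂ : Format) (j : ℕ)
    (hj : φ.quantum = 2 ^ j * (φ₁.quantum * φ₂.quantum)) {N : ℕ} (hN : φ.emaxCode - 1 + j ≤ N)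
    {x y : ℕ → ℚ} (hx : ∀ k, x k ∈ valueSet φ₁) (hy : ∀ k, y k ∈ valueSet φ₂) {s : ℚ}
    (hs : s ∈ valueSet φ) (n : ℕ) (f : ℚ → ℚ) :
    accExpQ (valueSet φ) (probAwayA N) (fun k => x k * y k) n f s
        = accExp (valueSet φ) (fun k => x k * y k) n f s ∧
    accExpQ (valueSet φ) (probAwayB N) (fun k => x k * y k) n f s
        = accExp (valueSet φ) (fun k => x k * y k) n f s ∧
    accExpQ (valueSet φ) (probAwayC N) (fun k => x k * y k) n f s
        = accExp (valueSet φ) (fun k => x k * y k) n f s := by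
  refine valueSet_acc_exact_of_grid φ j hN (fun k => ?_) hs n f
  have h : φ.quantum / 2 ^ j = φ₁.quantum * φ₂.quantum := by
    rw [hj, mul_div_cancel_left₀ _ (pow_ne_zero _ two_ne_zero)]
  rw [h]
  exact (MiniFloat.valueSet_onGrid φ₁ _ (hx k)).mul (MiniFloat.valueSet_onGrid φ₂ _ (hy k))

/-! ### Closed forms for the standard formats -/

/-- The budgets `(emaxCode − 1, + bias + m − 1)` of the standard formats: trees / one-stage inner
products need at most E2M1 `2/3`, E3M2 `6/10`, E2M3 `2/5`, E4M3 `14/23`, E5M2 `29/45`,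
binary16 `29/53`, bfloat16 `253/386`, binary32 `253/402` random bits. -/
theorem fp8_fp16_fp32_budgets :
    (Format.E2M1.emaxCode - 1 = 2 ∧ Format.E2M1.bias + Format.E2M1.manBits - 1 = 1) ∧
    (Format.E3M2.emaxCode - 1 = 6 ∧ Format.E3M2.bias + Format.E3M2.manBits - 1 = 4) ∧
    (Format.E2M3.emaxCode - 1 = 2 ∧ Format.E2M3.bias + Format.E2M3.manBits - 1 = 3) ∧
    (Format.E4M3.emaxCode - 1 = 14 ∧ Format.E4M3.bias + Format.E4M3.manBits - 1 = 9) ∧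
    (Format.E5M2.emaxCode - 1 = 29 ∧ Format.E5M2.bias + Format.E5M2.manBits - 1 = 16) ∧
    (Format.Binary16.emaxCode - 1 = 29 ∧ Format.Binary16.bias + Format.Binary16.manBits - 1 = 24) ∧
    (Format.BFloat16.emaxCode - 1 = 253 ∧
      Format.BFloat16.bias + Format.BFloat16.manBits - 1 = 133) ∧
    (Format.Binary32.emaxCode - 1 = 253 ∧
      Format.Binary32.bias + Format.Binary32.manBits - 1 = 149) := by
  decide

/-- **E4M3: fourteen random bits reproduce exact SR on every E4M3 summation tree.** -/
theorem e4m3_fourteenBits_tree_exact {N : ℕ} (hN : 14 ≤ N) (T : STree ℚ)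
    (hT : LeavesIn (valueSet Format.E4M3) T) (f : ℚ → ℚ) :
    treeExpQ (valueSet Format.E4M3) (probAwayA N) T f = treeExp (valueSet Format.E4M3) T f ∧
    treeExpQ (valueSet Format.E4M3) (probAwayB N) T f = treeExp (valueSet Format.E4M3) T f ∧
    treeExpQ (valueSet Format.E4M3) (probAwayC N) T f = treeExp (valueSet Format.E4M3) T f :=
  valueSet_tree_exact _ (by show 15 - 1 ≤ N; omega) T hT f

/-- **E5M2: twenty-nine random bits reproduce exact SR on every E5M2 summation tree.** -/
theorem e5m2_twentynineBits_tree_exact {N : ℕ} (hN : 29 ≤ N) (T : STree ℚ)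
    (hT : LeavesIn (valueSet Format.E5M2) T) (f : ℚ → ℚ) :
    treeExpQ (valueSet Format.E5M2) (probAwayA N) T f = treeExp (valueSet Format.E5M2) T f ∧
    treeExpQ (valueSet Format.E5M2) (probAwayB N) T f = treeExp (valueSet Format.E5M2) T f ∧
    treeExpQ (valueSet Format.E5M2) (probAwayC N) T f = treeExp (valueSet Format.E5M2) T f :=
  valueSet_tree_exact _ (by show 30 - 1 ≤ N; omega) T hT f

/-- **binary16: twenty-nine random bits reproduce exact SR on every binary16 summation tree.** -/
theorem binary16_tree_exact {N : ℕ} (hN : 29 ≤ N) (T : STree ℚ)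
    (hT : LeavesIn (valueSet Format.Binary16) T) (f : ℚ → ℚ) :
    treeExpQ (valueSet Format.Binary16) (probAwayA N) T f = treeExp (valueSet Format.Binary16) T f ∧
    treeExpQ (valueSet Format.Binary16) (probAwayB N) T f = treeExp (valueSet Format.Binary16) T f ∧
    treeExpQ (valueSet Format.Binary16) (probAwayC N) T f
      = treeExp (valueSet Format.Binary16) T f :=
  valueSet_tree_exact _ (by show 30 - 1 ≤ N; omega) T hT f

/-- **bfloat16: 253 random bits reproduce exact SR on every bfloat16 summation tree** (the budget is
the exponent range: `ulp_max/ulp_min = 2^253`). -/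
theorem bfloat16_tree_exact {N : ℕ} (hN : 253 ≤ N) (T : STree ℚ)
    (hT : LeavesIn (valueSet Format.BFloat16) T) (f : ℚ → ℚ) :
    treeExpQ (valueSet Format.BFloat16) (probAwayA N) T f = treeExp (valueSet Format.BFloat16) T f ∧
    treeExpQ (valueSet Format.BFloat16) (probAwayB N) T f = treeExp (valueSet Format.BFloat16) T f ∧
    treeExpQ (valueSet Format.BFloat16) (probAwayC N) T f
      = treeExp (valueSet Format.BFloat16) T f :=
  valueSet_tree_exact _ (by show 254 - 1 ≤ N; omega) T hT f

/-- **binary32: 253 random bits reproduce exact SR on every binary32 summation tree.** -/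
theorem binary32_tree_exact {N : ℕ} (hN : 253 ≤ N) (T : STree ℚ)
    (hT : LeavesIn (valueSet Format.Binary32) T) (f : ℚ → ℚ) :
    treeExpQ (valueSet Format.Binary32) (probAwayA N) T f = treeExp (valueSet Format.Binary32) T f ∧
    treeExpQ (valueSet Format.Binary32) (probAwayB N) T f = treeExp (valueSet Format.Binary32) T f ∧
    treeExpQ (valueSet Format.Binary32) (probAwayC N) T f
      = treeExp (valueSet Format.Binary32) T f :=
  valueSet_tree_exact _ (by show 254 - 1 ≤ N; omega) T hT f

/-- **E4M3 one-stage inner products: twenty-three bits.** -/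
theorem e4m3_ip_exact {N : ℕ} (hN : 23 ≤ N) {x y : ℕ → ℚ} (hx : ∀ k, x k ∈ valueSet Format.E4M3)
    (hy : ∀ k, y k ∈ valueSet Format.E4M3) {s : ℚ} (hs : s ∈ valueSet Format.E4M3) (n : ℕ)
    (f : ℚ → ℚ) :
    accExpQ (valueSet Format.E4M3) (probAwayA N) (fun k => x k * y k) n f s
        = accExp (valueSet Format.E4M3) (fun k => x k * y k) n f s ∧
    accExpQ (valueSet Format.E4M3) (probAwayB N) (fun k => x k * y k) n f s
        = accExp (valueSet Format.E4M3) (fun k => x k * y k) n f s ∧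
    accExpQ (valueSet Format.E4M3) (probAwayC N) (fun k => x k * y k) n f s
        = accExp (valueSet Format.E4M3) (fun k => x k * y k) n f s :=
  valueSet_ip_exact _ (by decide) (by show 15 - 1 + (7 + 3 - 1) ≤ N; omega) hx hy hs n f

/-- **E5M2 one-stage inner products: forty-five bits.** -/
theorem e5m2_ip_exact {N : ℕ} (hN : 45 ≤ N) {x y : ℕ → ℚ} (hx : ∀ k, x k ∈ valueSet Format.E5M2)
    (hy : ∀ k, y k ∈ valueSet Format.E5M2) {s : ℚ} (hs : s ∈ valueSet Format.E5M2) (n : ℕ)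
    (f : ℚ → ℚ) :
    accExpQ (valueSet Format.E5M2) (probAwayA N) (fun k => x k * y k) n f s
        = accExp (valueSet Format.E5M2) (fun k => x k * y k) n f s ∧
    accExpQ (valueSet Format.E5M2) (probAwayB N) (fun k => x k * y k) n f s
        = accExp (valueSet Format.E5M2) (fun k => x k * y k) n f s ∧
    accExpQ (valueSet Format.E5M2) (probAwayC N) (fun k => x k * y k) n f s
        = accExp (valueSet Format.E5M2) (fun k => x k * y k) n f s :=
  valueSet_ip_exact _ (by decide) (by show 30 - 1 + (15 + 2 - 1) ≤ N; omega) hx hy hs n f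

/-- **FP8 products accumulated in binary16.** E4M3·E4M3 (`2⁻¹⁸`) and E4M3·E5M2 (`2⁻²⁵`… no: `2⁻⁹·2⁻¹⁶`)
products: the binary16 quantum is `2⁻²⁴`, so E4M3·E4M3 products are ON the binary16 grid (`j = 0`,
`29` bits) while E4M3·E5M2 products need `j = 1` (`30` bits) and E5M2·E5M2 products `j = 8`
(`37` bits). Stated for the three pairs. -/
theorem fp8_products_in_binary16_exact {N : ℕ} {x y : ℕ → ℚ} {s : ℚ}
    (hs : s ∈ valueSet Format.Binary16) (n : ℕ) (f : ℚ → ℚ) :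
    ((29 ≤ N) → (∀ k, x k ∈ valueSet Format.E4M3) → (∀ k, y k ∈ valueSet Format.E4M3) →
      accExpQ (valueSet Format.Binary16) (probAwayA N) (fun k => x k * y k) n f s
        = accExp (valueSet Format.Binary16) (fun k => x k * y k) n f s) ∧
    ((30 ≤ N) → (∀ k, x k ∈ valueSet Format.E4M3) → (∀ k, y k ∈ valueSet Format.E5M2) →
      accExpQ (valueSet Format.Binary16) (probAwayA N) (fun k => x k * y k) n f s
        = accExp (valueSet Format.Binary16) (fun k => x k * y k) n f s) ∧
    ((37 ≤ N) → (∀ k, x k ∈ valueSet Format.E5M2) → (∀ k, y k ∈ valueSet Format.E5M2) →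
      accExpQ (valueSet Format.Binary16) (probAwayA N) (fun k => x k * y k) n f s
        = accExp (valueSet Format.Binary16) (fun k => x k * y k) n f s) := by
  have q16 : Format.Binary16.quantum = 1 / 2 ^ 24 := Format.Binary16_maxRat.2
  have q43 : Format.E4M3.quantum = 1 / 2 ^ 9 := Format.E4M3_maxRat.2
  have q52 : Format.E5M2.quantum = 1 / 2 ^ 16 := Format.E5M2_maxRat.2
  refine ⟨fun hN hx hy => ?_, fun hN hx hy => ?_, fun hN hx hy => ?_⟩
  · refine (valueSet_acc_exact_of_grid Format.Binary16 0 (by show 30 - 1 + 0 ≤ N; omega)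
      (fun k => ?_) hs n f).1
    have h := (MiniFloat.valueSet_onGrid _ _ (hx k)).mul (MiniFloat.valueSet_onGrid _ _ (hy k))
    rw [q43] at h; rw [q16]
    exact h.refine (j := 6) (by norm_num)
  · refine (valueSet_ip_exact_mixed Format.Binary16 Format.E4M3 Format.E5M2 1
      (by rw [q16, q43, q52]; norm_num) (by show 30 - 1 + 1 ≤ N; omega) hx hy hs n f).1
  · refine (valueSet_ip_exact_mixed Format.Binary16 Format.E5M2 Format.E5M2 8
      (by rw [q16, q52]; norm_num) (by show 30 - 1 + 8 ≤ N; omega) hx hy hs n f).1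

/-! ### Sharpness on the FP8 literals (kernel) -/

open Formats in
/-- E4M3: `-448 + 2⁻⁹` has up-probability `2⁻¹⁴` (not `13`-dyadic) and `-448 + 2⁻¹⁸` has `2⁻²³`
(not `22`-dyadic): the budgets `14` (trees, pairs) and `23` (one-stage inner products) are attained. -/
theorem e4m3_budget_witnesses :
    ¬ Dyadic 13 (pUp e4m3 ((-448 : ℚ) + 1 / 2 ^ 9)) ∧ Dyadic 14 (pUp e4m3 ((-448 : ℚ) + 1 / 2 ^ 9)) ∧
    ¬ Dyadic 22 (pUp e4m3 ((-448 : ℚ) + 1 / 2 ^ 18)) ∧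
      Dyadic 23 (pUp e4m3 ((-448 : ℚ) + 1 / 2 ^ 18)) := by
  refine ⟨by decide +kernel, by decide +kernel, by decide +kernel, by decide +kernel⟩

open Formats in
/-- E5M2: `-57344 + 2⁻¹⁶` has up-probability `2⁻²⁹` and `-57344 + 2⁻³²` has `2⁻⁴⁵`: the budgets `29`
and `45` are attained. -/
theorem e5m2_budget_witnesses :
    ¬ Dyadic 28 (pUp e5m2 ((-57344 : ℚ) + 1 / 2 ^ 16)) ∧
      Dyadic 29 (pUp e5m2 ((-57344 : ℚ) + 1 / 2 ^ 16)) ∧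
    ¬ Dyadic 44 (pUp e5m2 ((-57344 : ℚ) + 1 / 2 ^ 32)) ∧
      Dyadic 45 (pUp e5m2 ((-57344 : ℚ) + 1 / 2 ^ 32)) := by
  refine ⟨by decide +kernel, by decide +kernel, by decide +kernel, by decide +kernel⟩

open Formats in
/-- The FP8 literals are the substrate value sets, so the witnesses are witnesses for
`valueSet E4M3` / `valueSet E5M2` (bridge `e4m3_eq_valueSet`, `e5m2_eq_valueSet`). -/
theorem fp8_budget_witnesses_valueSet :
    ¬ Dyadic 13 (pUp (valueSet Format.E4M3) ((-448 : ℚ) + 1 / 2 ^ 9)) ∧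
    ¬ Dyadic 22 (pUp (valueSet Format.E4M3) ((-448 : ℚ) + 1 / 2 ^ 18)) ∧
    ¬ Dyadic 28 (pUp (valueSet Format.E5M2) ((-57344 : ℚ) + 1 / 2 ^ 16)) ∧
    ¬ Dyadic 44 (pUp (valueSet Format.E5M2) ((-57344 : ℚ) + 1 / 2 ^ 32)) := by
  rw [← e4m3_eq_valueSet, ← e5m2_eq_valueSet]
  exact ⟨e4m3_budget_witnesses.1, e4m3_budget_witnesses.2.2.1, e5m2_budget_witnesses.1,
    e5m2_budget_witnesses.2.2.1⟩

end Summit.Ventures.CertifiedArithmetic.LowPrec.SR.LimitedBits
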